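import Mathlib
import Literature.Analysis.FluidPDE.CheskidovFriedlander2009.DissipationAnomaly
import Literature.Analysis.FluidPDE.CheskidovFriedlander2009.FixedPoint
import HarnessLib

/-!
# Cheskidov–Friedlander 2009, Thm. 4.2 reduced to Thm. 3.4 and the existence of the fixed point

Cheskidov–Friedlander, Physica D 238 (2009) 783–787 = arXiv:0810.3718v1, proof of Thm. 4.2,
pp. 9–10, formalised step by step over `VanishingViscosityLimit.lean` and the proof files
`EnergyInequality.lean`, `DissipationAnomaly.lean`, `FixedPoint.lean`:

1. `limsup_T T⁻¹∫₀ᵀν‖a^ν‖²_{H¹} ≤ (α^ν,f)` — `CheskidovFriedlander2009_thm42_upper_of_globalAttractor`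
   (energy inequality + `a^ν(t) → α^ν`);
2. `liminf_T T⁻¹∫₀ᵀν‖a^ν‖²_{H¹} ≥ ν‖α^ν‖²_{H¹} − δ` via the truncation to `N` modes and
   "since `a^ν(t) → α^ν` in `l²`" — `thm42_lower_of_globalAttractor` below (Cesàro means of the truncated
   dissipation, monotone convergence);
3. `ν‖α^ν‖²_{H¹} = (α^ν,f)` ("since it is a regular solution") — `IsFixedPoint.energy_eq`;
4. `(α^ν,f) → (α⁰,f) = α⁰₀f₀ = ε_d` — `tendsto_epsilon_of_fixedPoints` (Lemma 2.3).

Assembled: `tendsto_meanDissipation_of_globalAttractor` (for every `ν > 0`, every non-negative `ℓ²` fixed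
point `α` and every solution `a` with non-negative datum, the long-time mean dissipation exists and
equals `f₀α₀`), and the **reduction**
`CheskidovFriedlander2009_thm42_of_globalAttractor`: the named fact `CheskidovFriedlander2009_thm42`
follows from the named fact `CheskidovFriedlander2009_globalAttractor` (Thm. 3.4 in its faithful form, non-negative fixed point) together with the existence, for
every `ν > 0`, of an `ℓ²` fixed point with non-negative entries (op. cit. §2: "The proof of the
existence of a solution to (2.1) follows from standard Navier–Stokes techniques in which fixed
point arguments are used for truncations of the system" — the one input not formalised in the
tree, taken here as an explicit hypothesis, not as a named fact).

No new definitions, no new facts.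
-/

noncomputable section

open Set MeasureTheory Filter
open scoped ENNReal BigOperators Topology

namespace Literature.Analysis.FluidPDE.CheskidovFriedlander2009

/-! ### Cesàro means and convergence of the modes -/

/-- Cesàro means of a function continuous on `[0,∞)` with a limit at `+∞` (the step "Since
`a^ν(t) → α^ν` in `l²`, we have `liminf_{T→∞} T⁻¹∫₀ᵀ νΣ_{j≤N}2^{2j}a^ν_j(t)² dt ≥ νΣ_{j≤N}2^{2j}(α^ν_j)²`"
of the printed proof). [cite: CheskidovFriedlander2009, Thm 4.2 p.10 (proof)] -/
theorem tendsto_cesaro {g : ℝ → ℝ} {L : ℝ} (hg : ContinuousOn g (Ici 0))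
    (hlim : Tendsto g atTop (𝓝 L)) :
    Tendsto (fun T : ℝ => T⁻¹ * ∫ t in (0 : ℝ)..T, g t) atTop (𝓝 L) := by
  rw [Metric.tendsto_atTop]
  intro ε hε
  obtain ⟨T₀, hT₀⟩ := Metric.tendsto_atTop.1 hlim (ε / 2) (half_pos hε)
  set T₁ : ℝ := max T₀ 1 with hT₁
  have hT₁0 : 0 < T₁ := lt_of_lt_of_le one_pos (le_max_right _ _)
  have hint : ∀ u v : ℝ, 0 ≤ u → u ≤ v → IntervalIntegrable (fun t => g t - L) volume u v :=
    fun u v hu huv => ((hg.sub continuousOn_const).mono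
      (fun t ht => hu.trans ht.1)).intervalIntegrable_of_Icc huv
  set C₀ : ℝ := |∫ t in (0 : ℝ)..T₁, (g t - L)| with hC₀
  refine ⟨max T₁ (2 * C₀ / ε + 1), fun T hT => ?_⟩
  have hTT₁ : T₁ ≤ T := (le_max_left _ _).trans hT
  have hT0 : 0 < T := hT₁0.trans_le hTT₁
  have hTC : 2 * C₀ / ε < T := by linarith [(le_max_right T₁ (2 * C₀ / ε + 1)).trans hT]
  have hgi : IntervalIntegrable g volume 0 T :=
    (hg.mono fun t ht => ht.1).intervalIntegrable_of_Icc hT0.le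
  have hmean : T⁻¹ * (∫ t in (0 : ℝ)..T, g t) - L = T⁻¹ * ∫ t in (0 : ℝ)..T, (g t - L) := by
    rw [intervalIntegral.integral_sub hgi intervalIntegrable_const, intervalIntegral.integral_const,
      sub_zero, smul_eq_mul]
    field_simp
  rw [Real.dist_eq, hmean]
  have hsplit : ∫ t in (0 : ℝ)..T, (g t - L) =
      (∫ t in (0 : ℝ)..T₁, (g t - L)) + ∫ t in T₁..T, (g t - L) :=
    (intervalIntegral.integral_add_adjacent_intervals (hint 0 T₁ le_rfl hT₁0.le)
      (hint T₁ T hT₁0.le hTT₁)).symm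
  have htail : |∫ t in T₁..T, (g t - L)| ≤ ε / 2 * |T - T₁| := by
    have h := intervalIntegral.norm_integral_le_of_norm_le_const (a := T₁) (b := T)
      (f := fun t => g t - L) (C := ε / 2) fun t ht => ?_
    · simpa [Real.norm_eq_abs] using h
    · rw [uIoc_of_le hTT₁] at ht
      have := hT₀ t ((le_max_left _ _).trans ht.1.le)
      rw [Real.dist_eq] at this
      simpa [Real.norm_eq_abs] using this.le
  have habsT : |T - T₁| ≤ T := by
    rw [abs_of_nonneg (by linarith)]
    linarith
  calc |T⁻¹ * ∫ t in (0 : ℝ)..T, (g t - L)|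
      = T⁻¹ * |(∫ t in (0 : ℝ)..T₁, (g t - L)) + ∫ t in T₁..T, (g t - L)| := by
        rw [abs_mul, abs_of_pos (inv_pos.mpr hT0), hsplit]
    _ ≤ T⁻¹ * (C₀ + ε / 2 * T) := by
        refine mul_le_mul_of_nonneg_left ?_ (inv_pos.mpr hT0).le
        calc |(∫ t in (0 : ℝ)..T₁, (g t - L)) + ∫ t in T₁..T, (g t - L)|
            ≤ C₀ + |∫ t in T₁..T, (g t - L)| := abs_add_le _ _
          _ ≤ C₀ + ε / 2 * T := by
              have : ε / 2 * |T - T₁| ≤ ε / 2 * T := mul_le_mul_of_nonneg_left habsT (by linarith)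
              linarith
    _ = C₀ / T + ε / 2 := by field_simp
    _ < ε / 2 + ε / 2 := by
        have : C₀ / T < ε / 2 := by
          rw [div_lt_iff₀ hT0]
          have hC0 : 0 ≤ C₀ := abs_nonneg _
          rw [div_lt_iff₀ hε] at hTC
          linarith
        linarith
    _ = ε := by ring

/-- If `|a(t) − α|² ≤ D₀e^{−κt}` (`κ > 0`) along a solution, every mode converges: `a_j(t) → α_j`.
[cite: CheskidovFriedlander2009, Thm 4.2 p.10 (proof)] -/
theorem tendsto_mode_of_exp_decay {c ν : ℝ} {f : ℕ → ℝ} {a : ℕ → ℝ → ℝ} {α : ℕ → ℝ}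
    (ha : IsSolution c ν f a) (hα : Summable fun j => α j ^ 2) {D₀ κ : ℝ} (hκ : 0 < κ)
    (hdec : ∀ t, 0 ≤ t → normSq (fun j => a j t - α j) ≤ D₀ * Real.exp (-(κ * t))) (j : ℕ) :
    Tendsto (fun t => a j t) atTop (𝓝 (α j)) := by
  have hsub : ∀ t, 0 ≤ t → Summable fun i => (a i t - α i) ^ 2 := by
    intro t ht
    have h2 : ∀ i, (a i t - α i) ^ 2 ≤ 2 * a i t ^ 2 + 2 * α i ^ 2 := fun i => by
      nlinarith [sq_nonneg (a i t + α i)]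
    exact Summable.of_nonneg_of_le (fun i => sq_nonneg _) h2
      (((ha.summable_sq t ht).mul_left 2).add (hα.mul_left 2))
  have hexp : Tendsto (fun t => D₀ * Real.exp (-(κ * t))) atTop (𝓝 0) := by
    have h1 : Tendsto (fun t => Real.exp (-(κ * t))) atTop (𝓝 0) := by
      have := Real.tendsto_exp_neg_atTop_nhds_zero.comp (tendsto_id.const_mul_atTop hκ)
      simpa [Function.comp_def] using this
    simpa using h1.const_mul D₀
  have hsq : Tendsto (fun t => (a j t - α j) ^ 2) atTop (𝓝 0) := by
    refine tendsto_of_tendsto_of_tendsto_of_le_of_le' tendsto_const_nhds hexp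
      (Eventually.of_forall fun t => sq_nonneg _) ?_
    filter_upwards [eventually_ge_atTop (0 : ℝ)] with t ht
    exact ((hsub t ht).le_tsum j fun _ _ => sq_nonneg _).trans (hdec t ht)
  have habs : Tendsto (fun t => |a j t - α j|) atTop (𝓝 0) := by
    simpa [Real.sqrt_sq_eq_abs] using hsq.sqrt
  have h0 : Tendsto (fun t => a j t - α j) atTop (𝓝 0) :=
    (tendsto_zero_iff_abs_tendsto_zero _).mpr habs
  simpa using h0.add_const (α j)

/-! ### The lower half of Thm. 4.2 -/

/-- The mean dissipation dominates the mean truncated dissipation: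
`ν T⁻¹∫₀ᵀ Σ_{j≤N}2^{2j}a_j² ≤ T⁻¹∫₀ᵀ ν‖a‖²_{H¹}` (`T > 0`; the dissipation integral is finite by
the energy inequality). [cite: CheskidovFriedlander2009, Thm 4.2 p.10 (proof)] -/
theorem IsSolution.truncated_le_meanDissipation {c ν f₀ : ℝ} {a : ℕ → ℝ → ℝ}
    (ha : IsSolution c ν (force f₀) a) (hc : c ≠ 0) (hν : 0 < ν) (hf : 0 ≤ f₀) (h0 : ∀ j, 0 ≤ a j 0)
    (N : ℕ) {T : ℝ} (hT : 0 < T) :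
    ν * (T⁻¹ * ∫ t in (0 : ℝ)..T, ∑ j ∈ Finset.range (N + 1), (2 : ℝ) ^ (2 * j) * a j t ^ 2) ≤
      meanDissipation ν a T := by
  unfold meanDissipation
  have hfin := ha.lintegral_h1NormSq_lt_top hc hν hf h0 le_rfl hT.le
  have hle : ENNReal.ofReal (∫ t in (0 : ℝ)..T, ∑ j ∈ Finset.range (N + 1),
      (2 : ℝ) ^ (2 * j) * a j t ^ 2) ≤ ∫⁻ t in Ioc (0 : ℝ) T, h1NormSq (fun j => a j t) := by
    rw [← ha.lintegral_truncDissipation_eq N le_rfl hT.le, ha.lintegral_h1NormSq_eq_iSup le_rfl]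
    exact le_iSup (fun M => ∫⁻ τ in Ioc (0 : ℝ) T, ∑ j ∈ Finset.range M,
      ENNReal.ofReal ((2 : ℝ) ^ (2 * j) * a j τ ^ 2)) (N + 1)
  have hnn : 0 ≤ ∫ t in (0 : ℝ)..T, ∑ j ∈ Finset.range (N + 1), (2 : ℝ) ^ (2 * j) * a j t ^ 2 :=
    intervalIntegral.integral_nonneg hT.le fun t _ =>
      Finset.sum_nonneg fun j _ => mul_nonneg (pow_nonneg zero_le_two _) (sq_nonneg _)
  have hreal : (∫ t in (0 : ℝ)..T, ∑ j ∈ Finset.range (N + 1), (2 : ℝ) ^ (2 * j) * a j t ^ 2) ≤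
      (∫⁻ t in Ioc (0 : ℝ) T, h1NormSq (fun j => a j t)).toReal := by
    have := ENNReal.toReal_mono hfin.ne hle
    rwa [ENNReal.toReal_ofReal hnn] at this
  have hT' : 0 ≤ T⁻¹ := (inv_pos.mpr hT).le
  gcongr

/-- **Proof of Thm. 4.2, second half** (p. 10), derived from the viscous attractor
`CheskidovFriedlander2009_globalAttractor`: for `c ∈ (3/2, 5/2]`, `ν > 0`, `f₀ > 0`, a non-negative `ℓ²`
fixed point `α` and a solution `a` with non-negative datum, `T⁻¹∫₀ᵀ ν‖a‖²_{H¹} ≥ f₀α₀ − δ` for all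
large `T` (any `δ > 0`): truncate to `N` modes with `νΣ_{j≤N}2^{2j}α_j² ≥ ν‖α‖²_{H¹} − δ/2`, use the
convergence of the modes and the steady energy equality `ν‖α‖²_{H¹} = f₀α₀`.
[cite: CheskidovFriedlander2009, Thm 4.2 p.10 (proof)] -/
theorem CheskidovFriedlander2009_thm42_lower_of_globalAttractor (h34 : CheskidovFriedlander2009_globalAttractor)
    {c ν f₀ : ℝ} (hc : 3 / 2 < c) (hc' : c ≤ 5 / 2) (hν : 0 < ν) (hf : 0 < f₀) {α : ℕ → ℝ}
    (hα : IsFixedPoint c ν (force f₀) α) (hαnn : ∀ j, 0 ≤ α j) {a : ℕ → ℝ → ℝ}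
    (ha : IsSolution c ν (force f₀) a) (h0 : ∀ j, 0 ≤ a j 0) {δ : ℝ} (hδ : 0 < δ) :
    ∀ᶠ T in atTop, f₀ * α 0 - δ ≤ meanDissipation ν a T := by
  obtain ⟨γ, hγ0, -, hatt⟩ := h34 c hc hc'
  have hc0 : c ≠ 0 := by linarith
  set κ : ℝ := 2 * γ * ν with hκdef
  have hκ : 0 < κ := by positivity
  set D₀ : ℝ := normSq (fun j => a j 0 - α j) with hD₀
  have hdec : ∀ t, 0 ≤ t → normSq (fun j => a j t - α j) ≤ D₀ * Real.exp (-(κ * t)) := by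
    intro t ht
    have := hatt ν f₀ hν hf α hα hαnn a ha h0 t ht
    simpa [hκdef, hD₀, mul_assoc] using this
  -- the steady energy equality and a truncation level `N`
  have hE := hα.energy_eq (by linarith) hν hαnn
  have hs := hα.summable_h1 hν hαnn
  have hsum : Tendsto (fun N => ν * ∑ j ∈ Finset.range (N + 1), (2 : ℝ) ^ (2 * j) * α j ^ 2)
      atTop (𝓝 (f₀ * α 0)) := by
    rw [← hE]
    exact ((hs.hasSum.tendsto_sum_nat).comp (tendsto_add_atTop_nat 1)).const_mul ν
  obtain ⟨N, hN⟩ := (hsum.eventually (lt_mem_nhds (by linarith : f₀ * α 0 - δ / 2 < f₀ * α 0)))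
    |>.exists
  -- Cesàro means of the truncated dissipation converge to `Σ_{j≤N}2^{2j}α_j²`
  have hmodes : Tendsto (fun t => ∑ j ∈ Finset.range (N + 1), (2 : ℝ) ^ (2 * j) * a j t ^ 2) atTop
      (𝓝 (∑ j ∈ Finset.range (N + 1), (2 : ℝ) ^ (2 * j) * α j ^ 2)) :=
    tendsto_finsetSum _ fun j _ =>
      ((tendsto_mode_of_exp_decay ha hα.1 hκ hdec j).pow 2).const_mul _
  have hcont : ContinuousOn (fun t => ∑ j ∈ Finset.range (N + 1), (2 : ℝ) ^ (2 * j) * a j t ^ 2)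
      (Ici 0) :=
    continuousOn_finsetSum _ fun j _ => continuousOn_const.mul ((ha.continuousOn j).pow 2)
  have hces := (tendsto_cesaro hcont hmodes).const_mul ν
  have hev : ∀ᶠ T in atTop, f₀ * α 0 - δ <
      ν * (T⁻¹ * ∫ t in (0 : ℝ)..T, ∑ j ∈ Finset.range (N + 1), (2 : ℝ) ^ (2 * j) * a j t ^ 2) :=
    hces.eventually (lt_mem_nhds (by linarith))
  filter_upwards [hev, eventually_gt_atTop (0 : ℝ)] with T hT hT0
  exact (hT.le.trans (ha.truncated_le_meanDissipation hc0 hν hf.le h0 N hT0))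

/-! ### Assembly -/

/-- **The long-time mean dissipation exists and equals `(α^ν,f) = f₀α^ν₀`** (the conclusion of
the proof of Thm. 4.2 at fixed `ν`, p. 10), derived from `CheskidovFriedlander2009_globalAttractor`: for
`c ∈ (3/2, 5/2]`, `ν > 0`, `f₀ > 0`, any non-negative `ℓ²` fixed point `α` and any solution `a`
with non-negative datum. [cite: CheskidovFriedlander2009, Thm 4.2 pp.9–10 (proof)] -/
theorem tendsto_meanDissipation_of_globalAttractor (h34 : CheskidovFriedlander2009_globalAttractor) {c ν f₀ : ℝ}
    (hc : 3 / 2 < c) (hc' : c ≤ 5 / 2) (hν : 0 < ν) (hf : 0 < f₀) {α : ℕ → ℝ}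
    (hα : IsFixedPoint c ν (force f₀) α) (hαnn : ∀ j, 0 ≤ α j) {a : ℕ → ℝ → ℝ}
    (ha : IsSolution c ν (force f₀) a) (h0 : ∀ j, 0 ≤ a j 0) :
    Tendsto (meanDissipation ν a) atTop (𝓝 (f₀ * α 0)) := by
  rw [tendsto_order]
  constructor
  · intro b hb
    have h := CheskidovFriedlander2009_thm42_lower_of_globalAttractor h34 hc hc' hν hf hα hαnn ha h0
      (half_pos (sub_pos.mpr hb))
    filter_upwards [h] with T hT
    linarith
  · intro b hb
    have h := CheskidovFriedlander2009_thm42_upper_of_globalAttractor h34 hc hc' hν hf hα hαnn ha h0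
      (half_pos (sub_pos.mpr hb))
    filter_upwards [h] with T hT
    linarith

/-- **Cheskidov–Friedlander 2009, Thm. 4.2 reduced to Thm. 3.4 and the existence of the fixed
point**: the named fact `CheskidovFriedlander2009_thm42` (the vanishing-viscosity limit of the
mean dissipation) follows from the named fact `CheskidovFriedlander2009_globalAttractor` (the global
attractor) and the existence, for every `c ∈ (3/2, 5/2]`, `ν > 0`, `f₀ > 0`, of an `ℓ²` fixed point
with non-negative entries (op. cit. §2, "standard Navier–Stokes techniques … fixed point arguments
… for truncations"; finite-energy steady states are positive by Lemma 2.1). With the fixed points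
`α^ν`, `L(ν) = f₀α^ν₀` (`tendsto_meanDissipation_of_globalAttractor`) and `L(ν) → ε_d`
(`tendsto_epsilon_of_fixedPoints`). [cite: CheskidovFriedlander2009, Thm 4.2 pp.9–10] -/
theorem CheskidovFriedlander2009_thm42_of_globalAttractor (h34 : CheskidovFriedlander2009_globalAttractor)
    (hex : ∀ c : ℝ, 3 / 2 < c → c ≤ 5 / 2 → ∀ ν f₀ : ℝ, 0 < ν → 0 < f₀ →
      ∃ α : ℕ → ℝ, IsFixedPoint c ν (force f₀) α ∧ ∀ j, 0 ≤ α j) :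
    CheskidovFriedlander2009_thm42 := by
  intro c hc hc' f₀ hf a ha
  -- a family of non-negative fixed points `α^ν`, `ν > 0` (arbitrary for `ν ≤ 0`)
  have hex' : ∀ ν : ℝ, ∃ α : ℕ → ℝ, 0 < ν → IsFixedPoint c ν (force f₀) α ∧ ∀ j, 0 ≤ α j := by
    intro ν
    by_cases hν : 0 < ν
    · obtain ⟨α, hα⟩ := hex c hc hc' ν f₀ hν hf
      exact ⟨α, fun _ => hα⟩
    · exact ⟨fun _ => 0, fun h => absurd h hν⟩
  choose α hα using hex'
  refine ⟨fun ν => f₀ * α ν 0, fun ν hν => ?_, ?_⟩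
  · exact tendsto_meanDissipation_of_globalAttractor h34 hc hc' hν hf (hα ν hν).1 (hα ν hν).2 (ha ν hν).1
      (ha ν hν).2
  · exact tendsto_epsilon_of_fixedPoints hc (by linarith) hf fun ν hν => hα ν hν

end Literature.Analysis.FluidPDE.CheskidovFriedlander2009

end
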